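import Summits.Ventures.YMGap.Thresholds.CouplingDerivativeSeries
import HarnessLib

/-!
# Venture YMGap — C-DIFF: THE STRONG-COUPLING STATE IS `C¹` IN THE COUPLING, WITH THE FLUCTUATION–RESPONSE
# FORMULA `d/dβ_W ⟨F⟩_{β_W} = Σ_q Cov_{β_W}(F, W_q)` (`SU(2)`, `d = 4`, every `0 < β_W < 9/25`)

HONEST FRAMING: venture file of the cell `pub-ymgap` (QuantumFields programme), seat ds-1.  Strong-coupling LATTICE
statement for `SU(2)` lattice Yang–Mills on `ℤ^4` with the Wilson action inside the one-sided vertex-star window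
`0 ≤ β_W ≤ 9/25` (tree bare coupling `β_W/2`, `W_q = ½ Re tr U_q`): differentiability of the (unique) DLR state in
the coupling on cylinder observables and the linear-response identity; NOT analyticity; nothing about the continuum,
confinement at weak coupling, or the Clay problem.  Mechanism (memo NEXT-STAR-WINDOW-CLIP, `C¹` paragraph):
exact torus derivative (`TorusStateResponse`) + uniform domination by the torus star clustering
(`TorusStateResponseBound`) + termwise convergence to the unique thermodynamic limit (Tannery,
`CouplingDerivativeSeries`) + dominated convergence under `∫ dβ` + continuity of the limit series ⇒ FTC.

For `β₁ ≤ 9/25`, a Lipschitz cylinder `F` (support `Λ`, constant `K`, links based within `D` of `x₀`) and ANY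
selection `μ : ℝ → states` with `μ β_W ∈ 𝒢(β_W)` on `[0, β₁]` (the DLR state is unique there, so the selection is
forced; one exists: `exists_dlrSelection`):
* ★ `su2_integral_sub_eq_intervalIntegral` — `⟨F⟩_{β'_W} − ⟨F⟩_{β_W} = ∫_{β_W}^{β'_W} Σ_q Cov_t(F, W_q) dt`;
* ★★ `su2_hasDerivAt_integral_star` / `_9_25` — `d/dβ_W ⟨F⟩_{β_W} = Σ_q Cov_{β_W}(F, W_q)` at every `0 < β_W < β₁`
  (resp. `< 9/25`): the state is `C¹` in the coupling on cylinder observables (derivative continuous on `[0, β₁]` by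
  `su2_continuousOn_responseSum`), derivative = the absolutely convergent static response (this seat's
  `LinearResponseBound` proved only its finiteness);
* `su2_hasDerivAt_plaquette_9_25` — the mean plaquette `u(β_W) = ⟨W_p⟩_{β_W}` is differentiable on `(0, 9/25)` with
  `u' = Σ_q Cov(W_p, W_q)` (the plaquette susceptibility): no first- or second-order transition of the lattice
  internal energy inside the window, as a kernel theorem.

References (mechanism only): B. Simon, *The Statistical Mechanics of Lattice Gases* I (1993), §II.1, §II.12;
R. L. Dobrushin, S. B. Shlosman (1985/87) (complete analyticity: `C^∞`/analytic dependence inside `C_V` — here only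
`C¹` is proved); W. Rudin, *Principles of Mathematical Analysis*, Thm. 7.17.
-/

noncomputable section

open MeasureTheory ProbabilityTheory Function Finset Filter Topology Real Set
open scoped NNReal
open Literature.Probability.LatticeModels (Torus.proj Torus.proj_apply)
open Literature.MathematicalPhysics.QuantumLattice (LGConfig ZdEdge ZdPlaquette plaquetteEdges torusLift torusEdge
  fundamentalRep continuous_fundamentalRep ymSpecification ymGibbsMeasures)
open Literature.MathematicalPhysics.QuantumFieldTheory hiding ZdEdge
open Summit.Ventures.YMGap.DSWindow (StarWindowBound starRate starRate_pos)
open Summit.Ventures.YMGap.StarWindowGauge (gaugeR gaugeR_lt_one_of_le)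
open Summit.Ventures.YMGap.StarLemmaG (gaugeR_nonneg)
open Summit.Ventures.YMGap.StarLimit (continuous_of_isLipschitzCylinder)
open Summit.Ventures.YMGap.RobustBall (l1 numOrient)
open Summit.Ventures.YMGap.LinearResponseBound (summable_and_tsum_base_le)

namespace Summit.Ventures.YMGap.CouplingResponse

/-! ### §4 The fluctuation–response formula -/

section Response

/-- **A DLR selection exists** (at every coupling a DLR state exists by compactness; on `[0, 9/25]` it is unique,
so every selection is THE strong-coupling state there). -/
theorem exists_dlrSelection :
    ∃ μ : ℝ → Measure (LGConfig 4 (Matrix.specialUnitaryGroup (Fin 2) ℂ)),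
      ∀ βW : ℝ, μ βW ∈ ymGibbsMeasures (d := 4) (fundamentalRep (Fin 2)) (2 * (βW / 4)) := by
  haveI : SecondCountableTopology (Matrix (Fin 2) (Fin 2) ℂ) :=
    inferInstanceAs (SecondCountableTopology (Fin 2 → Fin 2 → ℂ))
  haveI : SecondCountableTopology (Matrix.specialUnitaryGroup (Fin 2) ℂ) :=
    Topology.IsEmbedding.subtypeVal.secondCountableTopology
  choose μ hμ using fun βW : ℝ =>
    ymGibbsMeasures_nonempty (d := 4) (fundamentalRep (Fin 2)) (continuous_fundamentalRep (Fin 2)) (2 * (βW / 4))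
  exact ⟨μ, hμ⟩

/-- ★ **THE INTEGRATED FLUCTUATION–RESPONSE FORMULA** (`SU(2)`, `d = 4`, hypothesis-free): for `β₁ ≤ 9/25`, any DLR
selection `μ` on `[0, β₁]`, every Lipschitz cylinder `F` and all `β_W, β'_W ∈ [0, β₁]`:
`∫_{β_W}^{β'_W} (Σ_q Cov_{μ t}(F, W_q)) dt = ⟨F⟩_{μ β'_W} − ⟨F⟩_{μ β_W}` — limits of the exact torus identities
(`hasDerivAt_integral_torusState_SU`, chain rule `b = t/2`) under the uniform bound
(`su2_abs_responseSum_torusState_le`), with the torus states and their derivatives converging to the DLR state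
and the response series (`su2_tendsto_responseSum`); dominated convergence (`intervalIntegral_eq_sub_of_tendsto`). -/
theorem su2_integral_sub_eq_intervalIntegral {β₁ : ℝ} (h1 : β₁ ≤ 9 / 25)
    {μ : ℝ → Measure (LGConfig 4 (Matrix.specialUnitaryGroup (Fin 2) ℂ))}
    (hμ : ∀ βW ∈ Icc (0 : ℝ) β₁, μ βW ∈ ymGibbsMeasures (d := 4) (fundamentalRep (Fin 2)) (2 * (βW / 4)))
    {F : LGConfig 4 (Matrix.specialUnitaryGroup (Fin 2) ℂ) → ℝ} {Λ : Finset (ZdEdge 4)} {K : ℝ≥0}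
    (hF : IsLipschitzCylinder (fundamentalRep (Fin 2)) F Λ K)
    {x₀ : Literature.Probability.LatticeModels.Site 4} {D : ℕ} (hD : ∀ e ∈ Λ, ‖e.1 - x₀‖ ≤ D)
    {βW βW' : ℝ} (hb : βW ∈ Icc (0 : ℝ) β₁) (hb' : βW' ∈ Icc (0 : ℝ) β₁) :
    ∫ t in βW..βW', (∑' q : ZdPlaquette 4, cov[F, zdPlaquetteObs (fundamentalRep (Fin 2)) q.1 q.2.1.1 q.2.1.2; μ t]) =
      (∫ U, F U ∂(μ βW')) - ∫ U, F U ∂(μ βW) := by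
  classical
  haveI : SecondCountableTopology (Matrix (Fin 2) (Fin 2) ℂ) :=
    inferInstanceAs (SecondCountableTopology (Fin 2 → Fin 2 → ℂ))
  haveI : SecondCountableTopology (Matrix.specialUnitaryGroup (Fin 2) ℂ) :=
    Topology.IsEmbedding.subtypeVal.secondCountableTopology
  have hβ₁0 : 0 ≤ β₁ := hb.1.trans hb.2
  have hρ0 : 0 ≤ gaugeR β₁ := gaugeR_nonneg hβ₁0 (by linarith)
  have hρ1 : gaugeR β₁ < 1 := gaugeR_lt_one_of_le hβ₁0 h1
  have hFc : Continuous F := continuous_of_isLipschitzCylinder hF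
  have hFb : ∀ U, |F U| ≤ |F 1| + 2 * K := fun U => hF.abs_le U
  -- the shift `L₀ = 4D + 4` makes every torus in the sequence large enough
  set L₀ : ℕ := 4 * D + 4 with hL₀
  -- centred lifts for every torus side `n + 1`
  have hlift := fun n : ℕ => exists_centredLift (n + 1) x₀ (d := 4)
  choose s hs hcen hfix using hlift
  -- the finite-volume objects along the shifted sequence `n ↦ n + L₀ + 1`
  set φ : ℕ → ℝ → ℝ := fun n t =>
    ∫ U, F U ∂(torusState (d := 4) (fundamentalRep (Fin 2)) (t / 2) (n + L₀ + 1)) with hφ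
  set Dn : ℕ → ℝ → ℝ := fun n t => ∑ y : Site 4 (n + L₀ + 1), ∑ p : {p : Fin 4 × Fin 4 // p.1 < p.2},
    cov[F, zdPlaquetteObs (fundamentalRep (Fin 2)) (s (n + L₀) y) p.1.1 p.1.2;
      torusState (d := 4) (fundamentalRep (Fin 2)) (t / 2) (n + L₀ + 1)] with hDn
  set B : ℝ := numOrient 4 * (4 * (2 * Real.sqrt 2) ^ 2 * Real.exp (starRate (gaugeR β₁) * (D + 3)) *
    ((Λ.card : ℝ) * K) * 128 * ((1 + Real.exp (-(starRate (gaugeR β₁) / 4))) /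
      (1 - Real.exp (-(starRate (gaugeR β₁) / 4)))) ^ 4) with hB
  have hderiv : ∀ n, ∀ t ∈ Icc (0 : ℝ) β₁, HasDerivAt (φ n) (Dn n t) t := by
    intro n t _
    have h := hasDerivAt_integral_torusState_SU (d := 4) (N := 2) (L := n + L₀ + 1) hF.measurable hFb
      (hs (n + L₀)) (t / 2)
    have h2 : HasDerivAt (fun t : ℝ => t / 2) (1 / 2) t := by
      simpa using (hasDerivAt_id t).div_const 2
    have hc := h.comp t h2
    refine HasDerivAt.congr_deriv hc ?_
    rw [hDn]; simp only
    rw [Finset.sum_mul]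
    refine Finset.sum_congr rfl fun y _ => ?_
    rw [Finset.sum_mul]
    refine Finset.sum_congr rfl fun p _ => ?_
    push_cast; ring
  have hbound : ∀ n, ∀ t ∈ Icc (0 : ℝ) β₁, |Dn n t| ≤ B := by
    intro n t ht
    have hS : StarWindowBound (n + L₀ + 1) (2 * (t / 2)) (gaugeR β₁) suFrobDist :=
      su2_starWindowBound_uniform (by omega) (by linarith [ht.1]) (by linarith [ht.2]) h1
    have key := su2_abs_responseSum_torusState_le (L := n + L₀ + 1) (2 * (t / 2)) hρ0 hρ1 hS hF hD (by omega)
      (hs (n + L₀)) (hcen (n + L₀))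
    rw [show 2 * (t / 2) / 2 = t / 2 by ring] at key
    have e : ∑ y : Site 4 (n + L₀ + 1), ∑ p : {p : Fin 4 × Fin 4 // p.1 < p.2},
        ((2 : ℕ) : ℝ) * cov[F, zdPlaquetteObs (fundamentalRep (Fin 2)) (s (n + L₀) y) p.1.1 p.1.2;
          torusState (d := 4) (fundamentalRep (Fin 2)) (t / 2) (n + L₀ + 1)] = 2 * Dn n t := by
      rw [hDn]; simp only
      rw [Finset.mul_sum]
      refine Finset.sum_congr rfl fun y _ => ?_
      rw [Finset.mul_sum]
      refine Finset.sum_congr rfl fun p _ => ?_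
      push_cast; ring
    rw [e, abs_mul, abs_two] at key
    rw [hB]
    linarith
  have hφlim : ∀ t ∈ Icc (0 : ℝ) β₁, Tendsto (fun n => φ n t) atTop (𝓝 (∫ U, F U ∂(μ t))) := by
    intro t ht
    have hu := DSWindowZd.su2_hasUniqueGibbsMeasure_le_9_25 ht.1 (ht.2.trans h1)
    have e : ((2 : ℕ) : ℝ) * (t / 4) = t / 2 := by push_cast; ring
    have e' : (2 : ℝ) * (t / 4) = t / 2 := by ring
    rw [e] at hu
    have hμt := hμ t ht
    rw [e'] at hμt
    have h := tendsto_integral_torusState_of_subsingleton (d := 4) (fundamentalRep (Fin 2))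
      (continuous_fundamentalRep (Fin 2)) hu.1 hμt hFc hFb
    exact h.comp (tendsto_add_atTop_nat L₀)
  have hDlim : ∀ t ∈ Icc (0 : ℝ) β₁, Tendsto (fun n => Dn n t) atTop
      (𝓝 (∑' q : ZdPlaquette 4, cov[F, zdPlaquetteObs (fundamentalRep (Fin 2)) q.1 q.2.1.1 q.2.1.2; μ t])) := by
    intro t ht
    have h := su2_tendsto_responseSum h1 ht.1 ht.2 (hμ t ht) hF hD s hs hcen hfix
    exact h.comp (tendsto_add_atTop_nat L₀)
  exact intervalIntegral_eq_sub_of_tendsto hderiv hbound hφlim hDlim hb hb'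

/-- ★★ **THE FLUCTUATION–RESPONSE FORMULA / `C¹` IN THE COUPLING** (`SU(2)`, `d = 4`, hypothesis-free): for
`β₁ ≤ 9/25`, any DLR selection `μ` on `[0, β₁]` (forced: the state is unique there), every Lipschitz cylinder `F`,
and every `0 < β_W < β₁`:
`d/dβ_W ⟨F⟩_{μ β_W} = Σ_q Cov_{μ β_W}(F, W_q)` (`W_q = ½ Re tr U_q`; the series converges absolutely), and the
derivative is continuous on `[0, β₁]` (`su2_continuousOn_responseSum`). -/
theorem su2_hasDerivAt_integral_star {β₁ : ℝ} (h1 : β₁ ≤ 9 / 25)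
    {μ : ℝ → Measure (LGConfig 4 (Matrix.specialUnitaryGroup (Fin 2) ℂ))}
    (hμ : ∀ βW ∈ Icc (0 : ℝ) β₁, μ βW ∈ ymGibbsMeasures (d := 4) (fundamentalRep (Fin 2)) (2 * (βW / 4)))
    {F : LGConfig 4 (Matrix.specialUnitaryGroup (Fin 2) ℂ) → ℝ} {Λ : Finset (ZdEdge 4)} {K : ℝ≥0}
    (hF : IsLipschitzCylinder (fundamentalRep (Fin 2)) F Λ K)
    {x₀ : Literature.Probability.LatticeModels.Site 4} {D : ℕ} (hD : ∀ e ∈ Λ, ‖e.1 - x₀‖ ≤ D)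
    {βW : ℝ} (hb : βW ∈ Ioo (0 : ℝ) β₁) :
    HasDerivAt (fun t => ∫ U, F U ∂(μ t))
      (∑' q : ZdPlaquette 4, cov[F, zdPlaquetteObs (fundamentalRep (Fin 2)) q.1 q.2.1.1 q.2.1.2; μ βW]) βW := by
  have hβ₁0 : 0 ≤ β₁ := hb.1.le.trans hb.2.le
  refine hasDerivAt_of_intervalIntegral_eq (a := 0) (c := β₁) (fun t ht => ?_)
    (su2_continuousOn_responseSum h1 hμ hF hD) hb
  exact su2_integral_sub_eq_intervalIntegral h1 hμ hF hD (left_mem_Icc.2 hβ₁0) ht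

/-- ★★ **The instance `β₁ = 9/25`**: `d/dβ_W ⟨F⟩_{β_W} = Σ_q Cov_{β_W}(F, W_q)` at every `0 < β_W < 9/25 = 0.36`
('t Hooft `9/100`), for every Lipschitz cylinder observable and any DLR selection, hypothesis-free. -/
theorem su2_hasDerivAt_integral_9_25
    {μ : ℝ → Measure (LGConfig 4 (Matrix.specialUnitaryGroup (Fin 2) ℂ))}
    (hμ : ∀ βW ∈ Icc (0 : ℝ) (9 / 25), μ βW ∈ ymGibbsMeasures (d := 4) (fundamentalRep (Fin 2)) (2 * (βW / 4)))
    {F : LGConfig 4 (Matrix.specialUnitaryGroup (Fin 2) ℂ) → ℝ} {Λ : Finset (ZdEdge 4)} {K : ℝ≥0}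
    (hF : IsLipschitzCylinder (fundamentalRep (Fin 2)) F Λ K)
    {x₀ : Literature.Probability.LatticeModels.Site 4} {D : ℕ} (hD : ∀ e ∈ Λ, ‖e.1 - x₀‖ ≤ D)
    {βW : ℝ} (hb : βW ∈ Ioo (0 : ℝ) (9 / 25)) :
    HasDerivAt (fun t => ∫ U, F U ∂(μ t))
      (∑' q : ZdPlaquette 4, cov[F, zdPlaquetteObs (fundamentalRep (Fin 2)) q.1 q.2.1.1 q.2.1.2; μ βW]) βW :=
  su2_hasDerivAt_integral_star le_rfl hμ hF hD hb

/-- ★ **The mean plaquette is `C¹` on `(0, 9/25)` with derivative the plaquette susceptibility**: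
`d/dβ_W ⟨W_p⟩_{β_W} = Σ_q Cov_{β_W}(W_p, W_q)` for every plaquette `p`, any DLR selection — no first- or
second-order transition of the lattice internal energy inside the window. -/
theorem su2_hasDerivAt_plaquette_9_25
    {μ : ℝ → Measure (LGConfig 4 (Matrix.specialUnitaryGroup (Fin 2) ℂ))}
    (hμ : ∀ βW ∈ Icc (0 : ℝ) (9 / 25), μ βW ∈ ymGibbsMeasures (d := 4) (fundamentalRep (Fin 2)) (2 * (βW / 4)))
    (p : ZdPlaquette 4) {βW : ℝ} (hb : βW ∈ Ioo (0 : ℝ) (9 / 25)) :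
    HasDerivAt (fun t => ∫ U, zdPlaquetteObs (fundamentalRep (Fin 2)) p.1 p.2.1.1 p.2.1.2 U ∂(μ t))
      (∑' q : ZdPlaquette 4, cov[zdPlaquetteObs (fundamentalRep (Fin 2)) p.1 p.2.1.1 p.2.1.2,
        zdPlaquetteObs (fundamentalRep (Fin 2)) q.1 q.2.1.1 q.2.1.2; μ βW]) βW :=
  su2_hasDerivAt_integral_9_25 hμ (isLipschitzCylinder_zdPlaquetteObs (N := 2) p.1 p.2.2) (x₀ := p.1) (D := 1)
    (fun e he => by simpa using norm_fst_sub_le_of_mem_plaquetteEdges he) hb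

end Response

end Summit.Ventures.YMGap.CouplingResponse

end
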